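import Mathlib
import Summits.Ventures.PercRepro2.TypedSeparatedAll
import Summits.Ventures.PercRepro2.TypedUntouchedWeighted

/-!
# (HCOV) and the crux on weight vectors whose support separates the roots (blind cell PercRepro2,
night-3 g5, 2026-08-25; `proofs/NIGHT3-CERT.md` §14.9)

If `a₁ ↮ a₂` in the graph of the non-closed edges of `p` (`zmax p`), every minor met by the
three-copy reduction is a separated instance, so its typed bases are nonnegative
(`typedCount_nonneg_of_separated`) and the cleared covariance form `Gc = D · P(Q) · G` is
nonnegative (`Gc_nonneg_of_separated`): row 2′HCOV on that face of the cube, and the crux of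
record (ZΔ) with it (`ZDelta_of_separated`).
-/

namespace Summit.Ventures.PercRepro2

open UnionCluster

namespace CovForm

namespace Separated

open OneTyped TypedA3 Untouched TypedFactor

section Weighted

open Classical

variable {V : Type*} {E : Type*} [Fintype E] [DecidableEq E] {R : Type*} [Field R]
  [LinearOrder R] [IsStrictOrderedRing R]
variable (ends : E → Sym2 V) (o a₁ a₂ a₃ b : V)

omit [IsStrictOrderedRing R] in
/-- A minor met by the reduction — pinning agreeing with `zmax p` off the fractional set, typed
edges inside it — lies below `zmax p` once every typed edge is opened. -/
lemma zF_le_zmax (p : E → R) {z : Config E} (hz : ∀ e, e ∉ fracSet p → z e = zmax p e)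
    {G : Finset E} (hG : G ⊆ fracSet p) : zF G z ≤ zmax p := by
  intro e
  by_cases heG : e ∈ G
  · have : zmax p e = true := by
      have hf : e ∈ fracSet p := hG heG
      unfold fracSet at hf
      simp only [Finset.mem_filter, Finset.mem_univ, true_and] at hf
      simp [zmax, hf.1]
    simp [zF, this]
  · by_cases heS : e ∈ fracSet p
    · by_cases hze : z e = true
      · have : zmax p e = true := by
          unfold fracSet at heS
          simp only [Finset.mem_filter, Finset.mem_univ, true_and] at heS
          simp [zmax, heS.1]
        simp [zF, this]
      · simp [zF, heG, hze]
    · simp [zF, heG, hz e heS]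

omit [IsStrictOrderedRing R] in
/-- Such a minor is separated when `zmax p` separates the roots. -/
lemma sep_of_zmax (p : E → R) (hsep : ¬ Conn ends (zmax p) a₂ a₁) {z : Config E}
    (hz : ∀ e, e ∉ fracSet p → z e = zmax p e) {G : Finset E} (hG : G ⊆ fracSet p) :
    Sep ends a₁ a₂ G z :=
  fun h => hsep (conn_mono (zF_le_zmax p hz hG) h)

/-- **(HCOV) on the faces separating the roots**: if `a₁ ↮ a₂` in the graph of the non-closed
edges of `p`, then `0 ≤ Gc p`. -/
theorem Gc_nonneg_of_separated (p : E → R) (hp : IsProbVec p)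
    (hsep : ¬ Conn ends (zmax p) a₂ a₁) : 0 ≤ Gc p ends o a₁ a₂ a₃ b := by
  rw [hcov_cubic p ends o a₁ a₂ a₃ b (fun _ => 0)]
  suffices key : ∀ (q : E → R), (∀ e, e ∉ fracSet p → q e = p e) → (∀ e, 0 ≤ q e ∧ q e ≤ 1) →
      ∀ (F : Finset E), F ⊆ fracSet p → ∀ (τ : E → ℕ), (∀ e ∈ F, τ e = 1 ∨ τ e = 2) →
        0 ≤ triSum q F τ (K3 ends o a₁ a₂ a₃ b) by
    exact key p (fun _ _ => rfl) (fun e => ⟨hp.nonneg e, hp.le_one e⟩) ∅ (Finset.empty_subset _)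
      (fun _ => 0) (fun e he => absurd he (Finset.notMem_empty e))
  intro q hq hq01 F hF τ hτ
  generalize hn : (triFracFree q F).card = n
  induction n using Nat.strong_induction_on generalizing q F τ with
  | _ n ih =>
    by_cases h0 : triFracFree q F = ∅
    · have hpin : ∀ e, e ∉ F → q e = 0 ∨ q e = 1 := by
        intro e he
        by_contra hc
        rw [not_or] at hc
        have : e ∈ triFracFree q F := mem_triFracFree.mpr ⟨he, hc.1, hc.2⟩
        rw [h0] at this
        exact absurd this (Finset.notMem_empty e)
      rw [triSum_pinned_eq q F hpin τ _]
      have hz : ∀ e, e ∉ fracSet p → pinnedConfig q e = zmax p e := fun e he =>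
        pinnedConfig_eq_zmax_of_ne hq (fun e' he' => zero_or_one_of_notMem_fracSet he') he
      exact mul_nonneg (prod_typed_factors_nonneg q hq01 F τ)
        (typedCount_nonneg_of_separated ends o a₁ a₂ a₃ b F (pinnedConfig q) τ hτ
          (sep_of_zmax ends a₁ a₂ p hsep hz hF))
    · obtain ⟨e, he⟩ := Finset.nonempty_iff_ne_empty.mpr h0
      have heF : e ∉ F := (mem_triFracFree.mp he).1
      have heS : e ∈ fracSet p := by
        by_contra hc
        have hqe : q e = p e := hq e hc
        rcases zero_or_one_of_notMem_fracSet hc with h' | h'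
        · exact (mem_triFracFree.mp he).2.1 (hqe.trans h')
        · exact (mem_triFracFree.mp he).2.2 (hqe.trans h')
      have hlt : ((triFracFree q F).erase e).card < n := by
        rw [← hn]
        exact Finset.card_erase_lt_of_mem he
      have hq0 : ∀ e', e' ∉ fracSet p → Function.update q e 0 e' = p e' := by
        intro e' he'
        have hne : e' ≠ e := fun hh => he' (hh ▸ heS)
        rw [Function.update_of_ne hne]; exact hq e' he'
      have hq1 : ∀ e', e' ∉ fracSet p → Function.update q e 1 e' = p e' := by
        intro e' he'
        have hne : e' ≠ e := fun hh => he' (hh ▸ heS)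
        rw [Function.update_of_ne hne]; exact hq e' he'
      have hq0' : ∀ e', 0 ≤ Function.update q e 0 e' ∧ Function.update q e 0 e' ≤ 1 := by
        intro e'
        by_cases h : e' = e
        · subst h; simp
        · rw [Function.update_of_ne h]; exact hq01 e'
      have hq1' : ∀ e', 0 ≤ Function.update q e 1 e' ∧ Function.update q e 1 e' ≤ 1 := by
        intro e'
        by_cases h : e' = e
        · subst h; simp
        · rw [Function.update_of_ne h]; exact hq01 e'
      have hτ1 : ∀ e' ∈ insert e F, Function.update τ e 1 e' = 1 ∨ Function.update τ e 1 e' = 2 := by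
        intro e' he'
        by_cases hh : e' = e
        · subst hh; simp
        · rw [Function.update_of_ne hh]
          exact hτ e' (Finset.mem_of_mem_insert_of_ne he' hh)
      have hτ2 : ∀ e' ∈ insert e F, Function.update τ e 2 e' = 1 ∨ Function.update τ e 2 e' = 2 := by
        intro e' he'
        by_cases hh : e' = e
        · subst hh; simp
        · rw [Function.update_of_ne hh]
          exact hτ e' (Finset.mem_of_mem_insert_of_ne he' hh)
      have hF' : insert e F ⊆ fracSet p := Finset.insert_subset heS hF
      have hc0 : (triFracFree (Function.update q e 0) F).card =
          ((triFracFree q F).erase e).card := by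
        rw [triFracFree_update q F e 0 (Or.inl rfl)]
      have hc1 : (triFracFree (Function.update q e 1) F).card =
          ((triFracFree q F).erase e).card := by
        rw [triFracFree_update q F e 1 (Or.inr rfl)]
      have hc2 : (triFracFree q (insert e F)).card = ((triFracFree q F).erase e).card := by
        rw [triFracFree_insert]
      have h1 := ih _ hlt _ hq0 hq0' F hF τ hτ hc0
      have h2 := ih _ hlt _ hq1 hq1' F hF τ hτ hc1
      have h3 := ih _ hlt _ hq hq01 (insert e F) hF' _ hτ1 hc2
      have h4 := ih _ hlt _ hq hq01 (insert e F) hF' _ hτ2 hc2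
      rw [triSum_pin q heF τ _]
      have hqe := hq01 e
      have h1' : 0 ≤ (1 - q e) ^ 3 := by
        have : 0 ≤ 1 - q e := sub_nonneg.mpr hqe.2
        positivity
      have h2' : 0 ≤ (q e) ^ 3 := by
        have := hqe.1
        positivity
      have := mul_nonneg h1' h1
      have := mul_nonneg h2' h2
      linarith

/-- **The crux of record (ZΔ) on the faces separating the roots** (`ZDelta_of_HCov`). -/
theorem ZDelta_of_separated [Fintype V] [DecidableEq V] (p : E → R) (hp : IsProbVec p)
    (hsep : ¬ Conn ends (zmax p) a₂ a₁)
    (hord : prob p (connEvent ends a₁ b) ≤ prob p (connEvent ends a₂ b)) :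
    ZDelta p ends o a₁ a₂ a₃ b :=
  ZDelta_of_HCov p hp ends hord (Gc_nonneg_of_separated ends o a₁ a₂ a₃ b p hp hsep)

/-- **The vanishing bridge for minor-inherited rules**: if a property `P` of minors holds on every
minor met by the reduction (pinning agreeing with `zmax p` off the fractional set, typed edges
inside it) and forces the typed base to vanish, then `Gc p = 0`. -/
theorem Gc_eq_zero_of_minor_rule (p : E → R) (P : Finset E → Config E → Prop)
    (hP : ∀ (G : Finset E), G ⊆ fracSet p → ∀ z : Config E,
      (∀ e, e ∉ fracSet p → z e = zmax p e) → P G z)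
    (hrule : ∀ (G : Finset E) (z : Config E) (σ : E → ℕ), (∀ e ∈ G, σ e = 1 ∨ σ e = 2) → P G z →
      typedCount G z σ (K3 ends o a₁ a₂ a₃ b : Config E → Config E → Config E → R) = 0) :
    Gc p ends o a₁ a₂ a₃ b = 0 := by
  rw [hcov_cubic p ends o a₁ a₂ a₃ b (fun _ => 0)]
  suffices key : ∀ (q : E → R), (∀ e, e ∉ fracSet p → q e = p e) →
      ∀ (F : Finset E), F ⊆ fracSet p → ∀ (τ : E → ℕ), (∀ e ∈ F, τ e = 1 ∨ τ e = 2) →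
        triSum q F τ (K3 ends o a₁ a₂ a₃ b) = 0 by
    exact key p (fun _ _ => rfl) ∅ (Finset.empty_subset _) (fun _ => 0)
      (fun e he => absurd he (Finset.notMem_empty e))
  intro q hq F hF τ hτ
  generalize hn : (triFracFree q F).card = n
  induction n using Nat.strong_induction_on generalizing q F τ with
  | _ n ih =>
    by_cases h0 : triFracFree q F = ∅
    · have hpin : ∀ e, e ∉ F → q e = 0 ∨ q e = 1 := by
        intro e he
        by_contra hc
        rw [not_or] at hc
        have : e ∈ triFracFree q F := mem_triFracFree.mpr ⟨he, hc.1, hc.2⟩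
        rw [h0] at this
        exact absurd this (Finset.notMem_empty e)
      rw [triSum_pinned_eq q F hpin τ _]
      have hz : ∀ e, e ∉ fracSet p → pinnedConfig q e = zmax p e := fun e he =>
        pinnedConfig_eq_zmax_of_ne hq (fun e' he' => zero_or_one_of_notMem_fracSet he') he
      rw [hrule F (pinnedConfig q) τ hτ (hP F hF (pinnedConfig q) hz), mul_zero]
    · obtain ⟨e, he⟩ := Finset.nonempty_iff_ne_empty.mpr h0
      have heF : e ∉ F := (mem_triFracFree.mp he).1
      have heS : e ∈ fracSet p := by
        by_contra hc
        have hqe : q e = p e := hq e hc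
        rcases zero_or_one_of_notMem_fracSet hc with h' | h'
        · exact (mem_triFracFree.mp he).2.1 (hqe.trans h')
        · exact (mem_triFracFree.mp he).2.2 (hqe.trans h')
      have hlt : ((triFracFree q F).erase e).card < n := by
        rw [← hn]
        exact Finset.card_erase_lt_of_mem he
      have hq0 : ∀ e', e' ∉ fracSet p → Function.update q e 0 e' = p e' := by
        intro e' he'
        have hne : e' ≠ e := fun hh => he' (hh ▸ heS)
        rw [Function.update_of_ne hne]; exact hq e' he'
      have hq1 : ∀ e', e' ∉ fracSet p → Function.update q e 1 e' = p e' := by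
        intro e' he'
        have hne : e' ≠ e := fun hh => he' (hh ▸ heS)
        rw [Function.update_of_ne hne]; exact hq e' he'
      have hτ1 : ∀ e' ∈ insert e F, Function.update τ e 1 e' = 1 ∨ Function.update τ e 1 e' = 2 := by
        intro e' he'
        by_cases hh : e' = e
        · subst hh; simp
        · rw [Function.update_of_ne hh]
          exact hτ e' (Finset.mem_of_mem_insert_of_ne he' hh)
      have hτ2 : ∀ e' ∈ insert e F, Function.update τ e 2 e' = 1 ∨ Function.update τ e 2 e' = 2 := by
        intro e' he'
        by_cases hh : e' = e
        · subst hh; simp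
        · rw [Function.update_of_ne hh]
          exact hτ e' (Finset.mem_of_mem_insert_of_ne he' hh)
      have hF' : insert e F ⊆ fracSet p := Finset.insert_subset heS hF
      have hc0 : (triFracFree (Function.update q e 0) F).card =
          ((triFracFree q F).erase e).card := by
        rw [triFracFree_update q F e 0 (Or.inl rfl)]
      have hc1 : (triFracFree (Function.update q e 1) F).card =
          ((triFracFree q F).erase e).card := by
        rw [triFracFree_update q F e 1 (Or.inr rfl)]
      have hc2 : (triFracFree q (insert e F)).card = ((triFracFree q F).erase e).card := by
        rw [triFracFree_insert]
      have h1 := ih _ hlt _ hq0 F hF τ hτ hc0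
      have h2 := ih _ hlt _ hq1 F hF τ hτ hc1
      have h3 := ih _ hlt _ hq (insert e F) hF' _ hτ1 hc2
      have h4 := ih _ hlt _ hq (insert e F) hF' _ hτ2 hc2
      rw [triSum_pin q heF τ _, h1, h2, h3, h4]
      ring

/-- **(HCOV) is an equality when the support component of `a₂` carries no other mark**: if in
`zmax p` the component of `a₂` contains none of `a₁, o, b, a₃`, then `Gc p = 0`. -/
theorem Gc_eq_zero_of_hComponent_free_zmax (p : E → R)
    (h1 : ¬ Conn ends (zmax p) a₂ a₁) (ho : ¬ Conn ends (zmax p) a₂ o)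
    (hb : ¬ Conn ends (zmax p) a₂ b) (h3 : ¬ Conn ends (zmax p) a₂ a₃) :
    Gc p ends o a₁ a₂ a₃ b = 0 :=
  Gc_eq_zero_of_minor_rule ends o a₁ a₂ a₃ b p
    (fun G z => ¬ Conn ends (zF G z) a₂ a₁ ∧ ¬ Conn ends (zF G z) a₂ o ∧
      ¬ Conn ends (zF G z) a₂ b ∧ ¬ Conn ends (zF G z) a₂ a₃)
    (fun _ hG _ hz => ⟨fun h => h1 (conn_mono (zF_le_zmax p hz hG) h),
      fun h => ho (conn_mono (zF_le_zmax p hz hG) h),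
      fun h => hb (conn_mono (zF_le_zmax p hz hG) h),
      fun h => h3 (conn_mono (zF_le_zmax p hz hG) h)⟩)
    (fun _ _ σ hσ hP => typedCount_eq_zero_of_hComponent_free ends o a₁ a₂ a₃ b _ _ σ hσ
      hP.1 hP.2.1 hP.2.2.1 hP.2.2.2)

/-- **… the support component of `a₁`** (mirror). -/
theorem Gc_eq_zero_of_lComponent_free_zmax (p : E → R)
    (h2 : ¬ Conn ends (zmax p) a₂ a₁) (ho : ¬ Conn ends (zmax p) a₁ o)
    (hb : ¬ Conn ends (zmax p) a₁ b) (h3 : ¬ Conn ends (zmax p) a₁ a₃) :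
    Gc p ends o a₁ a₂ a₃ b = 0 :=
  Gc_eq_zero_of_minor_rule ends o a₁ a₂ a₃ b p
    (fun G z => ¬ Conn ends (zF G z) a₂ a₁ ∧ ¬ Conn ends (zF G z) a₁ o ∧
      ¬ Conn ends (zF G z) a₁ b ∧ ¬ Conn ends (zF G z) a₁ a₃)
    (fun _ hG _ hz => ⟨fun h => h2 (conn_mono (zF_le_zmax p hz hG) h),
      fun h => ho (conn_mono (zF_le_zmax p hz hG) h),
      fun h => hb (conn_mono (zF_le_zmax p hz hG) h),
      fun h => h3 (conn_mono (zF_le_zmax p hz hG) h)⟩)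
    (fun _ _ σ hσ hP => typedCount_eq_zero_of_lComponent_free ends o a₁ a₂ a₃ b _ _ σ hσ
      hP.1 hP.2.1 hP.2.2.1 hP.2.2.2)

/-- **(HCOV) is an equality when `o` reaches no root in the support.** -/
theorem Gc_eq_zero_of_oFree_zmax (p : E → R)
    (h1 : ¬ Conn ends (zmax p) a₁ o) (h2 : ¬ Conn ends (zmax p) a₂ o) :
    Gc p ends o a₁ a₂ a₃ b = 0 :=
  Gc_eq_zero_of_minor_rule ends o a₁ a₂ a₃ b p
    (fun G z => ¬ Conn ends (zF G z) a₁ o ∧ ¬ Conn ends (zF G z) a₂ o)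
    (fun _ hG _ hz => ⟨fun h => h1 (conn_mono (zF_le_zmax p hz hG) h),
      fun h => h2 (conn_mono (zF_le_zmax p hz hG) h)⟩)
    (fun _ _ σ hσ hP => typedCount_eq_zero_of_oFree ends o a₁ a₂ a₃ b _ _ σ hσ hP.1 hP.2)

/-- **(HCOV) is an equality when `b` reaches no root in the support.** -/
theorem Gc_eq_zero_of_bFree_zmax (p : E → R)
    (h1 : ¬ Conn ends (zmax p) a₁ b) (h2 : ¬ Conn ends (zmax p) a₂ b) :
    Gc p ends o a₁ a₂ a₃ b = 0 :=
  Gc_eq_zero_of_minor_rule ends o a₁ a₂ a₃ b p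
    (fun G z => ¬ Conn ends (zF G z) a₁ b ∧ ¬ Conn ends (zF G z) a₂ b)
    (fun _ hG _ hz => ⟨fun h => h1 (conn_mono (zF_le_zmax p hz hG) h),
      fun h => h2 (conn_mono (zF_le_zmax p hz hG) h)⟩)
    (fun _ _ σ hσ hP => typedCount_eq_zero_of_bFree ends o a₁ a₂ a₃ b _ _ σ hσ hP.1 hP.2)

end Weighted

end Separated

end CovForm

end Summit.Ventures.PercRepro2
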